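import Summits.Ventures.PercRepro.Night2FatZThreeB
import Summits.Ventures.PercRepro.Night2FatDegSingle

/-!
# night-2: the witnesses of the singly degenerate regime at small `N` — side points, free points, unloaded singletons — the case P₂ = {c}, |P₃| = 2

**`exists_small_witnesses_deg`**: for every lossy basis pair of the singly degenerate regime there are sets `U` of side
points, `V` of free points and `E` of points on no non-class basis line (unloaded singletons) of `W ∖ {x}` in one of
four patterns: (α) the line of `M` is not a non-class basis line, `|U| = 2`, `|V| = 1`, `|E| ≥ 2`;
(β) `|U| = 1`, `|V| = 3`, `|E| ≥ 2`; (γ) `|U| = 2`, `|V| = 2`, `|E| ≥ 1`; (δ) `|U| = 1`, `|V| = 2`, `|E| ≥ 3`.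
Each pattern gives the fair share at `N = 6, 7, 8` (`Night2FatDegNumIccA/B`).  The case analysis follows
`exists_side_and_free_deg`: `|P₂| ∈ {0, 1, 2, 3}` basis points of `π₂` off the spine.
Paper `proofs/NIGHT-2-g35.md` §5.
-/

namespace PercRepro.Shadow

open PercRepro.ThmH PercRepro.PerFlat

variable {α : Type*} [DecidableEq α] {M : Matroid α} [M.Finite] {G : Finset α}

/-- The small witnesses when `P₂ = {c}` and `|P₃| = 2` (`|L₀| = 1`): pattern (β) — two free points of `π₂` and a free spine point. -/
theorem deg_wit_case_p2_one_p3_two {w₀ x : α} {R₁ : Finset α} {c₂ c₃ : α} {B : Finset α} {z : α}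
    (hd : (gr M \ G).card = 2) (hk : kColoops M G = 1) (hs : ∀ e ∈ gr M, ∀ f ∈ gr M, e ≠ f → rkN M {e, f} = 2)
    (hfat : (fatClosures M 5 G 2).card ≤ 1) (hR₁2 : rkN M R₁ = 2) (hR₁3 : 3 ≤ R₁.card)
    (hcop : rkN M (insert w₀ (insert x R₁)) ≤ 3)
    (hnd₂ : 3 ≤ rkN M (((G \ coloops M G) \ {w₀, x}).filter (fun e => e ∈ clF M (insert c₂ R₁) ∧ e ∉ clF M R₁)))
    (hdeg₃ : rkN M (((G \ coloops M G) \ {w₀, x}).filter (fun e => e ∈ clF M (insert c₃ R₁) ∧ e ∉ clF M R₁)) ≤ 2)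
    {V P W Mset P₃ M' L₀ P₂ Aset Lset : Finset α} (hV : V = (G \ coloops M G) \ {w₀, x})
    (hP : P = (insert z B \ coloops M G).erase w₀) (hW : W = (G \ insert z B).erase x)
    (hMset : Mset = V.filter (fun e => e ∈ clF M (insert c₃ R₁) ∧ e ∉ clF M R₁))
    (hP₃ : P₃ = P.filter (fun e => e ∈ Mset)) (hM' : M' = W.filter (fun e => e ∈ Mset))
    (hL₀ : L₀ = P.filter (fun e => e ∈ clF M R₁))
    (hP₂ : P₂ = P.filter (fun e => e ∈ clF M (insert c₂ R₁) ∧ e ∉ clF M R₁))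
    (hAset : Aset = V.filter (fun e => e ∈ clF M (insert c₂ R₁) ∧ e ∉ clF M R₁))
    (hLset : Lset = V.filter (fun e => e ∈ clF M R₁)) {y₃ c : α} (hVg : V ⊆ gr M) (hPV : P ⊆ V)
    (hPind : M.Indep (P : Set α)) (hP4 : P.card = 4) (hMg : Mset ⊆ gr M) (hM3 : 3 ≤ Mset.card) (hM2 : 1 < Mset.card)
    (hP₃2₀ : P₃.card ≤ 2) (hMsplit : Mset.card = P₃.card + M'.card) (hM'1 : 1 ≤ M'.card) (hy₃ : y₃ ∈ W ∧ y₃ ∈ Mset)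
    (hy₃side : y₃ ∈ clF M (insert c₃ R₁) ∧ y₃ ∉ clF M R₁) (hL₀2 : L₀.card ≤ 2)
    (hπ₂3 : (P.filter (fun e => e ∈ clF M (insert c₂ R₁))).card ≤ 3) (hL₀P₂ : L₀.card + P₂.card ≤ 3)
    (hsplit : L₀.card + P₂.card + P₃.card = 4) (hAW : ∀ e ∈ Aset, e ∉ P₂ → e ∈ W) (hL3 : 3 ≤ Lset.card)
    (hLM : ∀ s ∈ Lset, ∀ s' ∈ Lset, s ≠ s' → s ∈ clF M Mset → s' ∉ clF M Mset)
    (hspineM : ∀ a ∈ L₀, ∀ c ∈ P₂, rkN M ({a, c} ∪ Mset) ≤ 3 → a ∈ clF M Mset)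
    (hfreeL : L₀.card ≤ 1 → ∀ s ∈ W, s ∈ clF M R₁ → s ∉ clF M Mset → (∀ c ∈ P₂, ∀ c' ∈ P₂, c ≠ c' → s ∈ clF M {c,
      c'} → rkN M (insert w₀ (insert x {c, c'})) ≤ 3 → 4 ≤ rkN M ({c, c'} ∪ Mset)) → s ∉ clF M Mset ∧ ∀ a ∈ P, ∀ b ∈
      P, a ≠ b → s ∈ clF M {a, b} → rkN M (insert w₀ (insert x {a, b})) ≤ 3 → 4 ≤ rkN M ({a, b} ∪ Mset))
    (hfreeA : ∀ f ∈ Aset, f ∈ W → (∀ a ∈ L₀, ∀ c ∈ P₂, a ≠ c → f ∈ clF M {a, c} → rkN M (insert w₀ (insert x {a,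
      c})) ≤ 3 → 4 ≤ rkN M ({a, c} ∪ Mset)) → (∀ c ∈ P₂, ∀ c' ∈ P₂, c ≠ c' → f ∈ clF M {c, c'} → rkN M (insert w₀
      (insert x {c, c'})) ≤ 3 → 4 ≤ rkN M ({c, c'} ∪ Mset)) → f ∉ clF M Mset ∧ ∀ a ∈ P, ∀ b ∈ P, a ≠ b → f ∈ clF M
      {a, b} → rkN M (insert w₀ (insert x {a, b})) ≤ 3 → 4 ≤ rkN M ({a, b} ∪ Mset))
    (hAoff : ∀ X : Finset α, rkN M X ≤ 2 → ∃ f ∈ Aset, f ∉ clF M X) (hA3 : 3 ≤ Aset.card)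
    (hsingA : ∀ f ∈ Aset, f ∈ W → (∀ a ∈ L₀, ∀ c ∈ P₂, a ≠ c → f ∈ clF M {a, c} → rkN M (insert w₀ (insert x {a,
      c})) ≤ 3) → (∀ c ∈ P₂, ∀ c' ∈ P₂, c ≠ c' → f ∈ clF M {c, c'} → rkN M (insert w₀ (insert x {c, c'})) ≤ 3) → ∀ a
      ∈ P, ∀ b ∈ P, a ≠ b → f ∈ clF M {a, b} → rkN M (insert w₀ (insert x {a, b})) ≤ 3)
    (hsingL : ∀ s ∈ W, s ∈ clF M R₁ → s ∉ clF M Mset → (∀ c ∈ P₂, ∀ c' ∈ P₂, c ≠ c' → s ∈ clF M {c, c'} → rkN M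
      (insert w₀ (insert x {c, c'})) ≤ 3) → ∀ a ∈ P, ∀ b ∈ P, a ≠ b → s ∈ clF M {a, b} → rkN M (insert w₀ (insert x
      {a, b})) ≤ 3)
    (hcmem : c ∈ P₂) (hcg : c ∈ gr M) (honly : ∀ c' ∈ P₂, c' = c)
    (hccvac : ∀ t : α, ∀ c' ∈ P₂, ∀ c'' ∈ P₂, c' ≠ c'' → t ∈ clF M {c', c''} → rkN M (insert w₀ (insert x {c',
      c''})) ≤ 3)
    (hccvac' : ∀ t : α, ∀ c' ∈ P₂, ∀ c'' ∈ P₂, c' ≠ c'' → t ∈ clF M {c', c''} → rkN M (insert w₀ (insert x {c',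
      c''})) ≤ 3 → 4 ≤ rkN M ({c', c''} ∪ Mset))
    (hA2 : 1 < (Aset.filter (fun e => e ∈ W)).card)
    (hLWcard : Lset.card ≤ (Lset.filter (fun e => e ∈ W)).card + L₀.card) (hP₂1 : 1 ≤ P₂.card) (hP₂1' : P₂.card < 2)
    (hP₃2 : 2 ≤ P₃.card) :
    ∃ U V E : Finset α, U ⊆ (G \ insert z B).erase x ∧ (∀ y ∈ U, y ∈ clF M (insert c₃ R₁) ∧ y ∉ clF M R₁) ∧ V ⊆ (G
      \ insert z B).erase x ∧ (∀ f ∈ V, f ∉ clF M (((G \ coloops M G) \ {w₀, x}).filter (fun e => e ∈ clF M (insert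
      c₃ R₁) ∧ e ∉ clF M R₁)) ∧ ∀ a ∈ (insert z B \ coloops M G).erase w₀, ∀ b ∈ (insert z B \ coloops M G).erase
      w₀, a ≠ b → f ∈ clF M {a, b} → rkN M (insert w₀ (insert x {a, b})) ≤ 3 → 4 ≤ rkN M ({a, b} ∪ (((G \ coloops M
      G) \ {w₀, x}).filter (fun e => e ∈ clF M (insert c₃ R₁) ∧ e ∉ clF M R₁)))) ∧ E ⊆ (G \ insert z B).erase x ∧ (∀
      y ∈ E, ∀ a ∈ (insert z B \ coloops M G).erase w₀, ∀ b ∈ (insert z B \ coloops M G).erase w₀, a ≠ b → y ∈ clF M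
      {a, b} → rkN M (insert w₀ (insert x {a, b})) ≤ 3) ∧ ((¬ (4 ≤ rkN M (insert w₀ (insert x (((G \ coloops M G) \
      {w₀, x}).filter (fun e => e ∈ clF M (insert c₃ R₁) ∧ e ∉ clF M R₁)))) ∧ ∃ a ∈ (insert z B \ coloops M G).erase
      w₀, ∃ b ∈ (insert z B \ coloops M G).erase w₀, a ≠ b ∧ a ∈ clF M (((G \ coloops M G) \ {w₀, x}).filter (fun e
      => e ∈ clF M (insert c₃ R₁) ∧ e ∉ clF M R₁)) ∧ b ∈ clF M (((G \ coloops M G) \ {w₀, x}).filter (fun e => e ∈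
      clF M (insert c₃ R₁) ∧ e ∉ clF M R₁))) ∧ U.card = 2 ∧ V.card = 1 ∧ 2 ≤ E.card) ∨ (U.card = 1 ∧ V.card = 3 ∧ 2
      ≤ E.card) ∨ (U.card = 2 ∧ V.card = 2 ∧ 1 ≤ E.card) ∨ (U.card = 1 ∧ V.card = 2 ∧ 3 ≤ E.card)) := by
  subst hV hP hW hMset hP₃ hM' hL₀ hP₂ hAset hLset
  set V := (G \ coloops M G) \ {w₀, x} with hV
  set P := (insert z B \ coloops M G).erase w₀ with hP
  set W := (G \ insert z B).erase x with hW
  set Mset := V.filter (fun e => e ∈ clF M (insert c₃ R₁) ∧ e ∉ clF M R₁) with hMset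
  set P₃ := P.filter (fun e => e ∈ Mset) with hP₃
  set M' := W.filter (fun e => e ∈ Mset) with hM'
  set L₀ := P.filter (fun e => e ∈ clF M R₁) with hL₀
  set P₂ := P.filter (fun e => e ∈ clF M (insert c₂ R₁) ∧ e ∉ clF M R₁) with hP₂
  set Aset := V.filter (fun e => e ∈ clF M (insert c₂ R₁) ∧ e ∉ clF M R₁) with hAset
  set Lset := V.filter (fun e => e ∈ clF M R₁) with hLset
  have _u := hd
  have _u := hk
  have _u := hfat
  have _u := hR₁2
  have _u := hR₁3
  have _u := hcop
  have _u := hnd₂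
  have _u := hdeg₃
  have _u := hP4
  have _u := hM3
  have _u := hM2
  have _u := hP₃2₀
  have _u := hMsplit
  have _u := hM'1
  have _u := hL₀2
  have _u := hπ₂3
  have _u := hL₀P₂
  have _u := hsplit
  have _u := hL3
  have _u := hA3
  have _u := hA2
  have _u := hLWcard
  have _u := hP₂1
  have _u := hP₂1'
  have _u := hP₃2
  have hL₀1 : L₀.card = 1 := by omega
  obtain ⟨a, haL₀⟩ := Finset.card_eq_one.1 hL₀1
  have hamem : a ∈ L₀ := by rw [haL₀]; exact Finset.mem_singleton_self a
  have haonly : ∀ e ∈ L₀, e = a := fun e he => by rw [haL₀, Finset.mem_singleton] at he; exact he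
  have haP : a ∈ P := (Finset.mem_filter.1 hamem).1
  have haL : a ∈ clF M R₁ := (Finset.mem_filter.1 hamem).2
  have hag : a ∈ gr M := hVg (hPV haP)
  -- `a ∉ clF M`: with the two side basis points, three basis points would lie in the rank-2 closure
  have haM : a ∉ clF M Mset := by
    intro haM
    have hsub : insert a P₃ ⊆ P.filter (fun e => e ∈ clF M Mset) := by
      intro t ht
      rw [Finset.mem_insert] at ht
      rcases ht with rfl | ht
      · exact Finset.mem_filter.2 ⟨haP, haM⟩
      · exact Finset.mem_filter.2 ⟨(Finset.mem_filter.1 ht).1,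
          subset_clF_of_subset_gr hMg (Finset.mem_filter.1 ht).2⟩
    have h1 := Finset.card_le_card hsub
    have h2 := card_filter_clF_le_two_of_indep hPind hdeg₃
    have haP₃ : a ∉ P₃ := fun h => (Finset.mem_filter.1 (Finset.mem_filter.1 h).2).2.2 haL
    rw [Finset.card_insert_of_notMem haP₃] at h1
    omega
  -- every point of `π₂` off the spine in `W` is free (the line `{a, c}` is not coplanar with `M`)
  have hfreeall : ∀ f ∈ Aset, f ∈ W → (f ∉ clF M Mset ∧ ∀ a' ∈ P, ∀ b ∈ P, a' ≠ b → f ∈ clF M {a', b} →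
      rkN M (insert w₀ (insert x {a', b})) ≤ 3 → 4 ≤ rkN M ({a', b} ∪ Mset)) := by
    intro f hf hfW
    refine hfreeA f hf hfW ?_ (hccvac' f)
    intro a' ha' c' hc' hac hfac hcls
    by_contra hcopl
    push Not at hcopl
    have ha'a : a' = a := haonly a' ha'
    subst ha'a
    exact haM (hspineM a' ha' c' hc' (by omega))
  obtain ⟨f₁, hf₁, f₂, hf₂, hf₁₂⟩ := Finset.one_lt_card.1 hA2
  rw [Finset.mem_filter] at hf₁ hf₂
  -- a spine point of `W` off `clF M`
  have hLW2 : 1 < (Lset.filter (fun e => e ∈ W)).card := by omega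
  obtain ⟨s, hsm, s', hs'm, hss'⟩ := Finset.one_lt_card.1 hLW2
  rw [Finset.mem_filter] at hsm hs'm
  obtain ⟨t, htm, htM⟩ : ∃ t, (t ∈ Lset ∧ t ∈ W) ∧ t ∉ clF M Mset := by
    by_cases hsM : s ∈ clF M Mset
    · exact ⟨s', hs'm, hLM s hsm.1 s' hs'm.1 hss' hsM⟩
    · exact ⟨s, hsm, hsM⟩
  have htL : t ∈ clF M R₁ := (Finset.mem_filter.1 htm.1).2
  have htfree := hfreeL (by omega) t htm.2 htL htM (hccvac' t)
  have htsing := hsingL t htm.2 htL htM (hccvac t)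
  -- a point of `π₂` off the spine in `W` and off the line `{a, c}`: on no non-class basis line
  have hac : a ≠ c := by
    rintro rfl
    exact (Finset.mem_filter.1 hcmem).2.2 haL
  obtain ⟨g, hg, hgoff⟩ := hAoff {a, c} (by rw [hs a hag c hcg hac])
  have hgc : g ≠ c := by
    rintro rfl
    exact hgoff (subset_clF_of_subset_gr (Finset.insert_subset hag (Finset.singleton_subset_iff.2 hcg))
      (Finset.mem_insert_of_mem (Finset.mem_singleton_self _)))
  have hgW : g ∈ W := hAW g hg (fun h => hgc (honly g h))
  have hgsing := hsingA g hg hgW (by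
    intro a' ha' c' hc' _ hgac
    exfalso
    have ha'a : a' = a := haonly a' ha'
    have hc'c : c' = c := honly c' hc'
    subst ha'a; subst hc'c
    exact hgoff hgac) (hccvac g)
  have htg : t ≠ g := by
    rintro rfl
    exact (Finset.mem_filter.1 hg).2.2 htL
  have htf₁ : t ≠ f₁ := by
    rintro rfl
    exact (Finset.mem_filter.1 hf₁.1).2.2 htL
  have htf₂ : t ≠ f₂ := by
    rintro rfl
    exact (Finset.mem_filter.1 hf₂.1).2.2 htL
  refine ⟨{y₃}, {t, f₁, f₂}, {t, g}, Finset.singleton_subset_iff.2 hy₃.1, ?_, ?_, ?_, ?_, ?_,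
    Or.inr (Or.inl ⟨Finset.card_singleton _, ?_, by rw [Finset.card_pair htg]⟩)⟩
  · intro y hy
    rw [Finset.mem_singleton] at hy
    subst hy
    exact hy₃side
  · intro f hf
    simp only [Finset.mem_insert, Finset.mem_singleton] at hf
    rcases hf with rfl | rfl | rfl
    · exact htm.2
    · exact hf₁.2
    · exact hf₂.2
  · intro f hf
    simp only [Finset.mem_insert, Finset.mem_singleton] at hf
    rcases hf with rfl | rfl | rfl
    · exact htfree
    · exact hfreeall f hf₁.1 hf₁.2
    · exact hfreeall f hf₂.1 hf₂.2
  · intro y hy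
    rw [Finset.mem_insert, Finset.mem_singleton] at hy
    rcases hy with rfl | rfl
    · exact htm.2
    · exact hgW
  · intro y hy
    rw [Finset.mem_insert, Finset.mem_singleton] at hy
    rcases hy with rfl | rfl
    · exact htsing
    · exact hgsing
  · rw [Finset.card_insert_of_notMem, Finset.card_pair hf₁₂]
    simp only [Finset.mem_insert, Finset.mem_singleton, not_or]
    exact ⟨htf₁, htf₂⟩

end PercRepro.Shadow
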